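import Summits.QuantumFields.YangMills.Theorems.UnitScaleTiltFluctuationComparisonRegPrGlobalSlackCanonicalOnChiChi
import Summits.QuantumFields.YangMills.Theorems.UnitScaleTiltFluctuationComparisonRegPrIntLChiV3
import HarnessLib

/-!
# `UnitScaleTiltFluctuationComparisonRegPrGlobalSlackCanonicalChiIntL` — v5kC WITH BOTH ANALYTIC χ-STUBS READ FROM THE CHART ROWS: «STUB 1 ∧ T8 ∧ 2′χ ∧ (K1a chart rows at the
# χ-record's canonical polymerisation, `L ≥ 7`) ∧ (the same with the three configuration rows on print's χ, `L < 7`) ⟹ FluctuationComparisonRegPrIntL»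
# (crux `FluctuationComparisonRegPrIntL`, stmt-QuantumFields-20520, skeleton v5kC (OWNER C3); width-lever lane B «(R1) print's χ of [Balaban1985UV3] (47) back», seat ym-ust-19935-r1 g4)

ONE composition: ★r1 g3's v5kC §2 engine `InteriorExcision.regPrIntL_of_v3ChiStubs` (p570604: STUB 1 → T8 → 2′χ → 3⁗χ → (i*)χ → `FluctuationComparisonRegPrIntL`) with 3⁗χ supplied
by `GlobalSlackCanonicalPolymers.globalTwoRunSlackFamChi_of_k1aChartRowsKChi` (`…CanonicalEndToEndChi`) and (i*)χ by `GlobalSlackCanonicalOnChi.smallBlocksSlackOnChiAllChi_of_k1aChartRowsOnChiChi`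
(`…CanonicalOnChiChi`).  So, BY NAME and with no `7 ≤ L` asymmetry hidden anywhere: the interior-excision crux follows from STUB 1 (closed in the tree), T8 ([Balaban1985Variational]
Thm 1 + (8), 19200's leaves), 2′χ (the re-typed (α) record), and the SIX CHART ROWS of the K1a interface at the χ-record's canonical polymerisation — on the whole sharp window for
`L ≥ 7` (`K1aChartRowsKChi`, no letter on the record), with the three configuration rows restricted to print's χ for `L ∈ {3,5}` (`K1aChartRowsOnChiChi`).  CONDITIONAL derivation
(every hypothesis is a schema); the conclusion is the Literature twin `T3InteriorExcision.FluctuationComparisonRegPrIntL` (= the route decl's body, `Iff.rfl`); closes nothing by itself;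
nothing of [Balaban1985UV3]/[King1986] is asserted; no numerics; registry untouched.

References: T. Bałaban, CMP 102 (1985) 255–275 [Balaban1985UV3] ((41) p.266, (43)–(47) pp.266–267, (57) p.270, Thm 2 p.272); CMP 102 (1985) 277–309 [Balaban1985Variational]
(Thm 1 (8) p.279); C. King, CMP 102 (1986) 649–677 [King1986] (Thm 3.4 (3.9) p.656, Prop. 3.6 p.662); T. Bałaban, CMP 109 (1987) 249–301 [Balaban1987RG1] ((0.4) p.253).
-/

set_option autoImplicit false

noncomputable section

namespace Summit.QuantumFields.YangMills.Theorems.InteriorExcision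

open MeasureTheory Filter
open Literature.MathematicalPhysics.QuantumFieldTheory.Balaban1983to89
open Literature.MathematicalPhysics.QuantumFieldTheory.Balaban1983to89.T3ContinuumYM3Torus
open Literature.MathematicalPhysics.QuantumFieldTheory.Balaban1983to89.T3UnitLawDensityEML (ℰp measurableE_ℰp)
open Literature.MathematicalPhysics.QuantumFieldTheory.Balaban1983to89.T3UnitScaleTilt
open Literature.MathematicalPhysics.QuantumFieldTheory.Balaban1983to89.T3PrintedMinimiserExistence
open Literature.MathematicalPhysics.QuantumFieldTheory.Balaban1983to89.T3SmallLiftHistory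
open Literature.MathematicalPhysics.QuantumFieldTheory.Balaban1983to89.T3LowerAlongMinimisersSplit (MinimisersIn8At)
open Literature.MathematicalPhysics.QuantumFieldTheory.Balaban1983to89.T3InteriorExcision
open Summit.QuantumFields.Balaban3D.Carriers
open Summit.QuantumFields.Balaban3D.Proofs.Primitives
open Summit.QuantumFields.YangMills.Theorems.GlobalSlackCanonicalPolymers (K1aChartRowsKChi globalTwoRunSlackFamChi_of_k1aChartRowsKChi)
open Summit.QuantumFields.YangMills.Theorems.GlobalSlackCanonicalOnChi (K1aChartRowsOnChiChi smallBlocksSlackOnChiAllChi_of_k1aChartRowsOnChiChi)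

/-- **v5kC WITH BOTH ANALYTIC χ-STUBS READ FROM THE K1a CHART ROWS AT THE χ-RECORD'S CANONICAL POLYMERISATION**: STUB 1 (`OneStepSmallLift` per `L`), T8 ([7] Thm 1 ∧ (8) per odd
`L > 1`), 2′χ (`AlphaInputsT3ACv3RecChi L`), the six chart rows at the record's decay rate for every odd `L ≥ 7` (`K1aChartRowsKChi`), and the six chart rows with the three
configuration rows on print's χ for every odd `1 < L < 7` and every margin (`K1aChartRowsOnChiChi`) give `FluctuationComparisonRegPrIntL`
(`regPrIntL_of_v3ChiStubs` ∘ (`globalTwoRunSlackFamChi_of_k1aChartRowsKChi`, `smallBlocksSlackOnChiAllChi_of_k1aChartRowsOnChiChi`)).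
[cite: Balaban1985UV3, (41) p.266, (43)-(47) pp.266-267, Thm 2 p.272; Balaban1985Variational, Thm 1 (8) p.279; King1986, Thm 3.4 (3.9) p.656; Balaban1987RG1, (0.4) p.253] -/
theorem regPrIntL_of_v3ChiRecord_k1aChartRowsChi
    (h1 : ∀ L : ℕ, ∃ κ δ₀ : ℝ, κ * Real.sqrt L ≤ 1 ∧ 0 < δ₀ ∧ ∀ F : T3Family, F.L = L → OneStepSmallLift F ℰp κ δ₀)
    (hT8 : ∀ L : ℕ, Odd L → 1 < L → ∃ a₀ a₁ B₃ : ℝ, 0 < a₀ ∧ 0 < a₁ ∧ 0 < B₃ ∧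
      Thm1GlobalMinAt L a₀ a₁ B₃ ∧ MinimisersIn8At L a₀ a₁ B₃)
    (h2 : ∀ L : ℕ, Odd L → 1 < L → Summit.QuantumFields.YangMills.Theorems.AlphaInputsT3ACv3RecChi L)
    (h3 : ∀ (L : ℕ), Odd L → 7 ≤ L → ∀ (𝔠 : AlphaConsts L (suGroupModel 2).N) (a₀ a₁ : ℝ), 0 < a₀ → 0 < a₁ → 𝔠.B₃ * a₁ ≤ a₀ →
      ∃ a : ℝ, 0 < a ∧ a < 1 ∧ K1aChartRowsKChi L 𝔠 a₀ a₁ a)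
    (hI : ∀ (L : ℕ), Odd L → 1 < L → L < 7 → ∀ (μ : ℝ), 0 < μ → μ < 1 → ∀ (𝔠 : AlphaConsts L (suGroupModel 2).N) (a₀ a₁ : ℝ),
      0 < a₀ → 0 < a₁ → 𝔠.B₃ * a₁ ≤ a₀ → ∃ a : ℝ, 0 < a ∧ a < 1 ∧ K1aChartRowsOnChiChi L μ 𝔠 a₀ a₁ a) :
    FluctuationComparisonRegPrIntL :=
  regPrIntL_of_v3ChiStubs h1 hT8 h2 (globalTwoRunSlackFamChi_of_k1aChartRowsKChi h3) (smallBlocksSlackOnChiAllChi_of_k1aChartRowsOnChiChi hI)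

end Summit.QuantumFields.YangMills.Theorems.InteriorExcision

end
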